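import Literature.Computability.Complexity.AlgebrizationBarriers
import HarnessLib

/-!
# Barrier catalogue `QuantumAdvantage`: algebrization (Aaronson–Wigderson 2008/2009)

D-0021 barrier entry for the summit `QuantumAdvantage`
(`Summits/QuantumAdvantage/QuantumAdvantage/Statement.lean`:
`QuantumAdvantage := ∃ L, L ∈ BQP ∧ L ∉ BPP`).

**The printed results.** Aaronson–Wigderson, *Algebrization: a new barrier in complexity
theory* (STOC 2008; held 50-page full version [AaronsonWigderson2008]; journal ACM TOCT 1 (2009)
[AaronsonWigderson2009]). Def. 2.3 (p. 9): the inclusion `C ⊆ D` *algebrizes* if `C^A ⊆ D^Ã`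
for all `A` and all low-degree extensions `Ã` of `A`; "proving `C ⊆ D` would require
non-algebrizing techniques" if there exist `A, Ã` with `C^A ⊄ D^Ã`; dually for separations.
§1 (table, p. 7): "Proving `NP ⊆ BQP`, `BPP = BQP`, etc. will require non-algebrizing
techniques." Thm. 5.11 (v) (pp. 27–28): there exist `A, Ã` (the multilinear extension) with
`BQP^A ⊄ BPP^Ã` (AW's sketch: Raz's exponential quantum/randomized communication separation via
the transfer principle, Thm. 4.11; see the audit note below on what that sketch needs). Thm. 5.2
(p. 23): there exist `A, Ã` with `PSPACE^{Ã[poly]} = P^A`; since `BQP ⊆ PSPACE` relativizes with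
polynomially many queries (Bernstein–Vazirani), `BQP^Ã ⊆ P^A ⊆ BPP^A` — so the separation
`BQP ⊄ BPP` does not algebrize either.

**Barrier audit 2026-08-16 (refuter; companion `AlgebrizationSymmetric.lean`).** The entry fact
is a tree theorem (`Algebrization_holds`, `AlgebrizationProofs.lean`); the audit CONFIRMS it and
NARROWS the block's technique-class and coverage claims as follows (page-level evidence in the
block). (1) *Direction asymmetry under iterated arithmetization.* For the separation `BQP ⊄ BPP`
(the summit) the barrier extends verbatim to AW's `k`-algebrization for every `k` (Thm. 10.2's
argument, p. 43: iterated multilinear extensions of a `PSPACE`-complete language stay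
`PSPACE`-complete) and to the symmetric both-sides-`Ã` form (companion,
`Algebrization.not_forall_symmetric_separation'`, proved); for the inclusion `BQP ⊆ BPP` only
level `k = 1` is excluded — AW p. 43: "for most of the other open problems … we do not know whether
double-algebrizing techniques already suffice", §11 (1) p. 46 — and no later source closes this
for `BQP` versus `BPP`. (2) *Technique class.* "Interactive proofs" is covered only in the
sum-check/arithmetization sense of AW §3 and §8; PCPs and local checkability are outside every
algebrization-type barrier (AW p. 29: Drucker's `A, Ã` with `NP^A ⊄ PCP^Ã`; AW §9 p. 42;
Aydınlıoğlu–Bach §1: "the PCP theorem is out of scope of this and related work"; IKK's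
`RCT ⊊ ACT ⊊ LCT`). (3) *Inference closure.* The inference-closed reformulations (IKK's `ACT`,
Aydınlıoğlu–Bach's affine relativization) relativize BOTH sides to the same algebraic oracle and
do not treat the quantum items in print (AB fn. 1; IKK §4.1.5); the symmetric forms for this pair
are supplied by the companion. (4) *Provenance of Thm. 5.11 (v).* The transfer principle
(Thm. 4.11, p. 22) turns a `T`-query algorithm on `Ã` into an `O(T n log |𝔽|)`-bit protocol, so
refuting `BQP^A ⊆ BPP^Ã` needs a predicate computed by a polynomial-QUERY quantum algorithm on
`A = (A₀ | A₁)` with large randomized communication cost; Raz's 1999 protocol has computationally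
unbounded players (Girish–Raz–Tal, §1: "in most of these separations, the quantum players are
inefficient"), and the tree's proof accordingly runs Raz–Tal's Forrelation on an XOR-masked window
(Girish–Raz–Tal's XOR-lifted Forrelation) with the Fourier growth of XOR-fibres
(`QuantumComplexity/AlgebraicForrelationFooling.lean`, whose design note records that the
unmasked Raz–Tal layout does not survive a single sub-cube-sum query to the multilinear
extension).

**What this file adds** (no new fact). Both oracle facts are the tree's
`Literature.Computability.Complexity.aaronsonWigderson2009_bqp_not_subset_bpp` (Thm. 5.11) and
`Literature.Computability.Complexity.aaronsonWigderson2009_bqp_subset_bpp_collapse` (the `BQP` instance of the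
Thm. 5.2 collapse, assembled there), with the technique class
`Literature.Computability.Complexity.IsAlgebrizingInclusion` / `IsAlgebrizingSeparation` (AW Def. 2.3,
`Algebrization.lean`) and the proved `not_isAlgebrizingInclusion_bqp_bpp`
(`AlgebrizationBarriers.lean`). Here: the catalogue decl `Algebrization` (conjunction of the two
facts, named not copied), its D-0021 block, and both no-go theorems PROVED — the inclusion
`BQP ⊆ BPP` (route `Dequantize`'s thesis) does not algebrize, for every presentation `C` of
`BQP^·` on language oracles (`∀ A, C (Oracle.ofLanguage A) = BQPRel A`, the hypothesis
`PresentsBQPRel C` of the sibling entry `Relativization.lean`, spelled out here), and the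
separation `BQP ⊄ BPP` (the summit) does not algebrize, for every presentation of `BQP^·` on
extension oracles through their bit language (`PresentsBQPRelExt`, the convention of
`AlgebrizationBarriers.lean`).

## Sources (locators verified with `lit read paper:doi-10-1145-1374376-1374481`)

* [AaronsonWigderson2008] full version: §1 table p. 7, Def. 2.1–2.3 pp. 8–9, §1.3 pp. 4–5,
  Thm. 5.1–5.3 p. 23, Thm. 5.11 pp. 27–28, §10.1 p. 43, §11 pp. 45–47. [AaronsonWigderson2009]
  is the journal version (key of the tree facts).
* [ImpagliazzoKabanetsKolokolova2009] §1 pp. 2–3 (algebrization not known closed under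
  inference; relativizing ⊆ algebrizing; `RCT ⊊ ACT ⊊ LCT`), §4 and §4.1 Lemma 4.3, §4.1.5
  (independence results via disjoint unions of self-algebrizing oracles; quantum items "we skip the
  details"), §5 (held as `paper:doi-10-1145-1536414-1536509`, an 18-chunk text extraction: section
  locators only, no page numbers).
* [AydinliogluBach2018] (ECCC TR16-040 read): abstract and §1 pp. 2–3 (closure under inference;
  fn. 1: quantum classes not pursued; PCP out of scope), §1.1 p. 7 (affine oracles: multilinear
  extensions over `GF(2^k)`, both sides relativized).
* [GirishRazTal2022] §1 (efficiency of the quantum players in communication separations;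
  XOR-lifted Forrelation), [RazTalJACM2022] Thm. 7.4, Claim 8.2, App. A — the sources of the
  tree's proof of Thm. 5.11 (v).
* [ChenHuRen2025] §1.2 (algebrization "not necessarily closed under modus ponens"; barriers w.r.t.
  multilinear extensions align with affine relativization), §1.5 (arXiv text, section locators).
-/

noncomputable section

namespace Literature.Barriers.QuantumAdvantage

open _root_.Computability Literature.Computability.Complexity Literature.Computability.Cryptography

/-! ### Presenting `BQP^·` on extension oracles -/

/-- `PresentsBQPRelExt C`: on extension oracles `Ã` the oracle-indexed class `C` is `BQP`
relative to the bit language of `Ã` (quantum XOR-query access to the Boolean presentation of the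
field-valued oracle, polynomial-time equivalent to it) — the convention under which
`AlgebrizationBarriers.lean` states the `BQP` collapse. Inhabited by
`fun O => BQPRel (Oracle.bitLanguage O)` (`presentsBQPRelExt_bit`). [cite: AaronsonWigderson2008, Def. 2.1–2.3 (pp. 8–9) and §1.3.2 (Boolean queries)] -/
def PresentsBQPRelExt (C : Oracle → Set (Language Bool)) : Prop :=
  ∀ Ã : ExtensionOracle, C Ã.toOracle = BQPRel (Oracle.bitLanguage Ã.toOracle)

/-- The bit-language presentation satisfies `PresentsBQPRelExt`. [folklore] -/
theorem presentsBQPRelExt_bit : PresentsBQPRelExt fun O => BQPRel (Oracle.bitLanguage O) :=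
  fun _ => rfl

/-! ### The barrier fact -/

/-- **Algebrization barrier for `BQP` versus `BPP`** (Aaronson–Wigderson: Thm. 5.11 (v),
`A, Ã` with `BQP^A ⊄ BPP^Ã`; Thm. 5.2 with Bernstein–Vazirani, `A, Ã` with `BQP^Ã ⊆ BPP^A`).
By definition the conjunction of the tree facts
`aaronsonWigderson2009_bqp_subset_bpp_collapse ∧ aaronsonWigderson2009_bqp_not_subset_bpp`
(`AlgebrizationBarriers.lean`; named, not copied).

BARRIER
technique_class: algebrizing (AW Def. 2.3, one side receives `Ã`; for the separation direction also k-algebrizing for every `k` and the symmetric both-sides-`Ã` form), arithmetization, low-degree-extension, interactive-proofs (sum-check / arithmetization style only: LFKN–Shamir, BFL, GMW as algebrized in AW §3, §8 — NOT PCPs or local checkability, see scope_caveats), relativizing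
blocks: algebrizing proofs (AW Def. 2.3; tree `IsAlgebrizingSeparation` / `IsAlgebrizingInclusion`) of the summit `QuantumAdvantage` read as the separation `BQP ⊄ BPP` (`Algebrization.not_isAlgebrizingSeparation_bqp_bpp`, proved) AND of its negation `BQP ⊆ BPP`, the thesis `DeqThesis` of route `Dequantize` (`Algebrization.not_isAlgebrizingInclusion_bqp_bpp`, proved; tree `not_isAlgebrizingInclusion_bqp_bpp`): "Proving `NP ⊆ BQP`, `BPP = BQP`, etc. will require non-algebrizing techniques" [cite: AaronsonWigderson2008, §1 (table, p. 7), Thm. 5.11 (v) (pp. 27–28), Thm. 5.2 (p. 23)]; in particular sum-check style arithmetization, the technique behind the known non-relativizing inclusions, cannot by itself prove either direction. For the SEPARATION direction the block is robust: the same `PSPACE`-complete world kills `k`-algebrizing proofs for every constant `k` (iterated multilinear extensions stay `PSPACE`-complete, the argument of AW Thm. 10.2 verbatim with `BQP^{·} ⊆ PSPACE^{·[poly]}` in place of `NP`) [cite: AaronsonWigderson2008, §10.1 Prop. 10.1 and Thm. 10.2 (p. 43)] and kills proofs relativizing with respect to extension oracles given to BOTH sides (`Algebrization.not_forall_symmetric_separation'`,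 companion `AlgebrizationSymmetric.lean`, proved). For the INCLUSION direction only single-level (`k = 1`) algebrization is excluded (see evasions_known), and the symmetric form is proved only modulo the Boolean-query monotonicity `BQP^A ⊆ BQP^{bit Ã}` (`Algebrization.not_forall_symmetric_inclusion_of_mono`).
because: the known arithmetization results algebrize because the verifier can query the extension `Ã` wherever the arithmetized formula contains oracle gates [cite: AaronsonWigderson2008, §1.3 (pp. 4–5) and §3]; for `A` `PSPACE`-complete and `Ã` its multilinear extension (again `PSPACE`-computable, Babai–Fortnow–Lund) `PSPACE^{Ã[poly]} = P^A` [cite: AaronsonWigderson2008, Thm. 5.2 (p. 23)], and `BQP^Ã ⊆ PSPACE^{Ã[poly]}` by the relativizing simulation of Bernstein–Vazirani, whence `BQP^Ã ⊆ P^A ⊆ BPP^A` (tree theorem `aaronsonWigderson2009_bqp_subset_bpp_collapse_holds`; the tree's world is an autoreducible collapse oracle with its multilinear extension); conversely `BQP^A ⊄ BPP^Ã` with `Ã` multilinear [cite: AaronsonWigderson2008, Thm. 5.11 (v) (p. 28)]: AW's printed sketch ("Raz gave an exponential separation between randomized and quantum communication complexities for a promise problem … hence `BQP^A ⊄ BPP^Ã`")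 goes through the transfer principle, which converts a `T`-query algorithm on `Ã` into an `O(T n log |𝔽|)`-bit two-party protocol [cite: AaronsonWigderson2008, Thm. 4.11 (p. 22)] and therefore needs a predicate computed by a polynomial-QUERY quantum algorithm on `A = (A₀ | A₁)` whose randomized communication cost is large — Raz's protocol has computationally unbounded players ("in most of these separations, the quantum players are inefficient"; the first separations with efficient quantum players are lifted Forrelation and XOR-lifted Forrelation) [cite: GirishRazTal2022, §1]; the tree's proof (`aaronsonWigderson2009_bqp_not_subset_bpp_holds`, via `QuantumComplexity/AlgebraicForrelationFooling.lean` and `OracleSeparationBQPBPPAlgebraic.lean`) runs Raz–Tal's Forrelation machine on an XOR-masked window `x_n = R_n ⊕ Y_n` and bounds every `BPP^Ã` machine by the transfer principle plus the Fourier growth of XOR-fibres [cite: RazTalJACM2022, Thm. 7.4 and Claim 8.2] [cite: GirishRazTal2022, §1]; its design note records that the unmasked Raz–Tal layout is useless against multilinear access (one extension query returns an exact sub-cube sum of a block, and products of such sums correlate with `x_n ∼ 𝒟₁`).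
evasions_known: (i) ITERATED ("`k`-") ARITHMETIZATION for the inclusion direction: no `A` with a double extension `Ã̃` and `BQP^A ⊄ BPP^{Ã̃}` is known — "for most of the other open problems mentioned in this paper … we do not know whether double-algebrizing techniques already suffice" [cite: AaronsonWigderson2008, §10.1 (p. 43)], "we have no idea whether double-arithmetization is already powerful enough to prove P = RP or NEXP ⊄ P/poly" [cite: AaronsonWigderson2008, §11 (1) (p. 46)]; the transfer principle does not extend (a double extension at a non-Boolean point is not a cheap two-party computation), and neither inference-closed reformulation treats the quantum items [cite: AydinliogluBach2018, §1 (fn. 1)] [cite: ImpagliazzoKabanetsKolokolova2009, §4.1.5]; nothing later closes it for `BQP ⊆ BPP` (audit 2026-08-16: arXiv/galaxy searches; the 2025 algebrization barriers concern circuit classes [cite: ChenHuRen2025, §1.2 and §1.5]); audit reasoning, not in print: IKK's weaker notion is routinely closed — a disjoint union `A₁ + A₂` of self-algebrizing encodings stays arithmetically checkable [cite: ImpagliazzoKabanetsKolokolova2009, §4.1 (Lemma 4.3)] and each query to it is answered by one player with one bit, so XOR-lifted Forrelation [cite: GirishRazTal2022, §1] yields an `ACT*`-consistent world with `BQP ⊄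 BPP`; but AW's double extension of `A₁ + A₂` has cross terms `bit_i((1 − b)·Ã₁(x) + b·Ã₂(x))` at non-Boolean `b`, not reducible to `A₁ + A₂`, so neither this nor the transfer principle reaches `k ≥ 2` — the cheapest closing move is a direct lower bound for `BPP` machines with double-extension access on the tree's XOR-masked Forrelation layout (a barrier-candidate). For the separation direction (the summit) this evasion is CLOSED by Thm. 10.2's argument (blocks). (ii) PCPs / LOCAL CHECKABILITY are outside every algebrization-type barrier: Drucker's `A, Ã` with `NP^A ⊄ PCP^Ã` ("a sense in which the PCP Theorem is non-algebrizing") [cite: AaronsonWigderson2008, §5.4 (p. 29)], "about other non-relativizing techniques [our results] are comparatively silent" (local checkability, time-space trade-offs) [cite: AaronsonWigderson2008, §9 (p. 42)], "the PCP theorem is out of scope of this and related work" [cite: AydinliogluBach2018, §1 (p. 3)], `ACT ⊊ LCT` [cite: ImpagliazzoKabanetsKolokolova2009, §1 (Our results) and §5]. (iii) Aaronson–Wigderson's general suggestions — exploit the structure of arithmetized polynomials (an arithmetized 3SAT formula can be recovered from its extension by factoring), richer algebras — are not specific to quantum classes [cite: AaronsonWigderson2008, §11 (pp. 45–47)] [cite: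 ImpagliazzoKabanetsKolokolova2009, §5 (Conclusions)]. (iv) Conditional separations (`FACTORING ∉ BPP ⟹` summit, routes `Shor`, `AvgCase`) and restricted-model separations are untouched, the barrier concerning unconditional proofs of the two class relations only [cite: AaronsonWigderson2008, Def. 2.3 (p. 9)].
scope_caveats: AW's notion covers inclusions and separations only, is asymmetric (one side receives `Ã`) and is not closed under inference, so algebrizing premises might combine into a non-algebrizing conclusion [cite: ImpagliazzoKabanetsKolokolova2009, §1 (p. 2)] [cite: AaronsonWigderson2008, §10.1 (p. 42–43)] [cite: ChenHuRen2025, §1.2]; in the tree's vocabulary an inclusion and the opposite separation can even both "algebrize" for an artificial presentation (`exists_isAlgebrizingInclusion_and_isAlgebrizingSeparation`, companion: the two predicates read the left class on the disjoint oracle families `Oracle.ofLanguage A` / `Ã.toOracle`), which is why the no-go theorems carry presentation hypotheses — they quantify over presentations `C` of `BQP^·` agreeing with `BQPRel` on language oracles (the sibling entry's `PresentsBQPRel`, inhabited there by `bqpRelOf`) resp. satisfying `PresentsBQPRelExt` (extension oracles, inhabited by `presentsBQPRelExt_bit`); the inference-closed, symmetric reformulations — arithmetic checkability `ACT` [cite: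 ImpagliazzoKabanetsKolokolova2009, §1 (Our results)] and affine relativization [cite: AydinliogluBach2018, §1.1 (p. 7)] — do not treat `BQP` versus `BPP` in print (AB fn. 1; IKK §4.1.5), the companion proves the symmetric forms available in the tree (collapse and separation-no-go hypothesis-free; separation and inclusion-no-go modulo `BQP^A ⊆ BQP^{bit Ã}`, no tree lemma yet substitutes query gates inside uniform Clifford+T families); affine oracles are multilinear extensions over `GF(2^k)` [cite: AydinliogluBach2018, §1.1 (p. 7)] whereas the tree's `ExtensionOracle` carries prime fields `ZMod p` only (AW: all finite fields [cite: AaronsonWigderson2008, Def. 2.2 (p. 8)]), so no statement here is literally about affine oracles — on paper both AW arguments are field-independent; tree model: `BQPRel` with XOR-query gates to a LANGUAGE, so quantum access to `Ã` goes through `Oracle.bitLanguage` (design note of `AlgebrizationBarriers.lean`, whose docstrings cite "Thm 5.11 (iv)" — the item is (v); (iv) is `NP^A ⊄ BQP^Ã`); the collapse fact is the tree's assembled COROLLARY of Thm. 5.2 plus relativized `BQP ⊆ PSPACE`, not a verbatim AW statement for `BQP` [cite: AaronsonWigderson2008, Thm. 5.2 (p. 23)].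
status: established (theorem: `Algebrization_holds`, both oracle facts discharged in the tree; the no-go readings and the symmetric forms are proved here and in the companion) [cite: AaronsonWigderson2008, Thm. 5.11 (v), Thm. 5.2] -/
def Algebrization : Prop :=
  aaronsonWigderson2009_bqp_subset_bpp_collapse ∧ aaronsonWigderson2009_bqp_not_subset_bpp

/-- `Algebrization` from the two tree facts. [cite: AaronsonWigderson2008, Thm. 5.11 (v) and Thm. 5.2] -/
theorem Algebrization.of_aw (h₁ : aaronsonWigderson2009_bqp_subset_bpp_collapse)
    (h₂ : aaronsonWigderson2009_bqp_not_subset_bpp) : Algebrization :=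
  ⟨h₁, h₂⟩

/-- Unfolding: the two oracle facts spelled out. [cite: AaronsonWigderson2008, Thm. 5.11 (v) and Thm. 5.2] -/
theorem algebrization_iff :
    Algebrization ↔
      (∃ (A : Language Bool) (Ã : ExtensionOracle), Ã.IsExtensionOf A 1 ∧
          BQPRel (Oracle.bitLanguage Ã.toOracle) ⊆ BPPRel (Oracle.ofLanguage A)) ∧
        ∃ (A : Language Bool) (Ã : ExtensionOracle), Ã.IsExtensionOf A 1 ∧
          ¬ BQPRel A ⊆ BPPRel Ã.toOracle :=
  Iff.rfl

/-! ### The no-go theorems in Aaronson–Wigderson's vocabulary (proved) -/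

/-- **"Proving `BQP ≠ BPP` requires non-algebrizing techniques"**: the separation `BQP ⊄ BPP` —
the summit, read over the relativized classes — is not an algebrizing separation
(`IsAlgebrizingSeparation C BPPRel`) for any presentation `C` of `BQP^·` on extension oracles.
[cite: AaronsonWigderson2008, Thm. 5.2 with Def. 2.3] -/
theorem Algebrization.not_isAlgebrizingSeparation_bqp_bpp (h : Algebrization)
    {C : Oracle → Set (Language Bool)} (hC : PresentsBQPRelExt C) :
    ¬ IsAlgebrizingSeparation C BPPRel := by
  obtain ⟨⟨A, Ã, hÃ, hsub⟩, -⟩ := h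
  intro halg
  refine halg A Ã 1 hÃ ?_
  rw [hC Ã]
  exact hsub

/-- **"Proving `BPP = BQP` requires non-algebrizing techniques"**: the inclusion `BQP ⊆ BPP` —
route `Dequantize`'s thesis, read over the relativized classes — is not an algebrizing inclusion
(`IsAlgebrizingInclusion C BPPRel`) for any presentation `C` of `BQP^·` on language oracles
(the tree theorem `not_isAlgebrizingInclusion_bqp_bpp`). [cite: AaronsonWigderson2008, Thm. 5.11 (v) with Def. 2.3] -/
theorem Algebrization.not_isAlgebrizingInclusion_bqp_bpp (h : Algebrization)
    {C : Oracle → Set (Language Bool)} (hC : ∀ A : Language Bool, C (Oracle.ofLanguage A) = BQPRel A) :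
    ¬ IsAlgebrizingInclusion C BPPRel :=
  Literature.Computability.Complexity.not_isAlgebrizingInclusion_bqp_bpp h.2 hC

/-- Both no-go statements at once, for a presentation agreeing with `BQPRel` on language oracles
and with `BQPRel ∘ bitLanguage` on extension oracles. [cite: AaronsonWigderson2008, §1 (table, p. 7)] -/
theorem Algebrization.summary (h : Algebrization) {C : Oracle → Set (Language Bool)}
    (hC : ∀ A : Language Bool, C (Oracle.ofLanguage A) = BQPRel A) (hCext : PresentsBQPRelExt C) :
    ¬ IsAlgebrizingSeparation C BPPRel ∧ ¬ IsAlgebrizingInclusion C BPPRel :=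
  ⟨h.not_isAlgebrizingSeparation_bqp_bpp hCext, h.not_isAlgebrizingInclusion_bqp_bpp hC⟩

/-- The canonical instance of the separation no-go, for `O ↦ BQP^{bitLanguage O}` (no presentation
hypothesis left; the inclusion no-go is instantiated hypothesis-free in the sibling entry's
vocabulary by `bqpRelOf`, `Relativization.lean`). [cite: AaronsonWigderson2008, §1 (table, p. 7)] -/
theorem Algebrization.not_isAlgebrizingSeparation_bit (h : Algebrization) :
    ¬ IsAlgebrizingSeparation (fun O => BQPRel (Oracle.bitLanguage O)) BPPRel :=
  h.not_isAlgebrizingSeparation_bqp_bpp presentsBQPRelExt_bit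

/-- The algebraic collapse oracle is in particular a (plain) collapsing oracle in the sense of the
sibling entry: it yields `A'` with `BQP^{A'} ⊆ BPP^{A}` where `A'` is the bit language of `Ã`
(compare `Relativization`, whose collapsing oracle has `A' = A`). [cite: AaronsonWigderson2008, Thm. 5.2] -/
theorem Algebrization.exists_collapse (h : Algebrization) :
    ∃ (A : Language Bool) (Ã : ExtensionOracle),
      BQPRel (Oracle.bitLanguage Ã.toOracle) ⊆ BPPRel (Oracle.ofLanguage A) := by
  obtain ⟨⟨A, Ã, -, hsub⟩, -⟩ := h
  exact ⟨A, Ã, hsub⟩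

end Literature.Barriers.QuantumAdvantage

end
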